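import Summits.QuantumFields.YangMills.Theorems.BalabanUVNodesK3AxV8Defs
import Summits.QuantumFields.YangMills.Theorems.BalabanUVNodesN20KeyedRelWeightAtGap2ReadingCmap

/-!
# Route «BalabanUVNodes», crux K3ᴬ `SpineGivenEndpointR13SepCoPHVAx` (stmt-QuantumFields-27247), node N20 = NE7b — NODE N20's STUB-2 SHARE **BY NAME AT THE MIRROR**
# (`K3AxV8Defs`, dag-n16-e ✓p812015): the v8 pin `PinnedAtLiveGap2` at its intended witness (`rfl`, every cut reading), the N20 conjunct `KeyedRelWeight` at the
# doubly-gapped re-centred reading — OUTRIGHT at the zero cut reading, from a keyed witness family at any cut reading — and THE STUB-2 BILL WITH NODE N20 PAID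

Cell `pub-ymgap` (HUMAN RULING D-0062, Track A), seat `pub-ymgap-dag-n20-d` (gen 46; R134 (a) N20 s3).  `--kind proof --supports stmt-QuantumFields-27247 --as helper` (count-neutral;
proves NO registered stub — §3's theorems have hypotheses; nothing registered, the plan keeps the registered skeleton `K3Skeleton13SepCoPHAxV8` b38fad1764a2d455).  Over M1
`Thm/BalabanUVNodesK3AxV8Defs` (the registered §1 ∕ §1b ∕ §1V ∕ §1c texts BY NAME, Theses-free: `SpineReading`, `CutReading`, `KeyedRelWeight`, `KeyedShellWeight`, `KeyedExtractionV`,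
`KeyedCoreEdgeHolderD4V`, `PinnedAtLiveGap2`, `DialRows`, `GuardedReadingN16`, `KeyedRatesHolderD4V`, `rrOfRecord`) and this lineage's `Thm/BalabanUVNodesN20KeyedRelWeightAtGap2ReadingCmap`
(✓p811026: the N20 column at the doubly-gapped χ-reading, whose §4 binder shapes ARE the mirror's `KeyedRelWeight` bodies — the same text, :412 of the kit = :209 of the mirror).
The pattern is dag-n16-e's `Thm/BalabanUVNodesN16Stub1ShareK3AxV8` (node N16's stub-1 share at the mirror).
[LF-II] = [Balaban1989LargeFieldII].

CONTENTS.  §1 THE PIN AT ITS INTENDED WITNESS: `pinnedAtLiveGap2_gap2Reading jc ρ ρ′ n₁ n₂` — for EVERY cut reading `jc` the reading `fun F θ hP g₀ os ↦ crGap2₁₃VAx (jc F θ hP g₀ os) ρ ρ′ n₁ n₂ F θ hP g₀ os`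
satisfies `PinnedAtLiveGap2 jc ρ ρ′ n₁ n₂ ·` (`rfl`; pinned EVERYWHERE, the live-line antecedent unused) · `pinnedAtLiveGap2_crGap2₁₃VAx` (tuple-blind policy `jcut`).  §2 NODE N20's
CONJUNCT: ★★ `keyedRelWeight_crGap2₁₃VAx_cutZero ρ ρ′ n₁ n₂ : KeyedRelWeight (crGap2₁₃VAx (fun _ ↦ 0) ρ ρ′ n₁ n₂)` — OUTRIGHT, every dial (the empty bad class, `W ≡ 0`;
✓p811026 §4) · ★ `keyedRelWeight_gap2Reading_of_witness jc ρ ρ′ n₁ n₂ W hW` — at ANY cut reading from a keyed family of `RelWeightBound` witnesses at the gapped re-centred carriers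
(the socket a PRICED N20 face plugs into).  §3 ★★ THE BILL `stub2Text_of_cutZero_faces`: a supplier of the dial rows and of the N21 ∕ N27x ∕ N19′ conjuncts (`KeyedShellWeight`,
`KeyedExtractionV`, `KeyedCoreEdgeHolderD4V β · (rrOfRecord 𝔯 ksel)`) at `crGap2₁₃VAx (fun _ ↦ 0) ρ ρ′ n₁ n₂` for some dials, per `β` and guarded K4-faced reading ⟹ THE REGISTERED STUB-2
TEXT (spelled; = `K3AxV8StubTexts.Stub2TextV8` ∕ the type of `K3Skeleton13SepCoPHAxV8.stub_expansion13HV`, byte for byte, by `Iff.rfl`) — node N20's conjunct and the pin no longer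
appear among the hypotheses; ★ `stub2Text_of_faces_at_cutReading`: the same at ANY per-tuple cut reading `jc`, where N20 enters as the witness family `W, hW` of §2 (HYPOTHESIS — the
priced face; NE7b NOT PRINTED for `d = 4`).  After this file the stub-2 text's NODE-N20 content reads: NOTHING at `jc ≡ 0`; `hW` at a nonzero cut.

WHAT IT SAYS (located, count-neutral): the v8 closer's N20 obligation is discharged BY NAME at the zero cut reading; the cut's content sits in the JOINT choice with
`KeyedCoreEdgeHolderD4V` (good class = ALL of `classSet₁₃Ax` at `jc ≡ 0`, ✓p811026 `classSet₁₃Ax_sdiff_badClass₁₃Ax_cutZero`) — plan g81 (t-JC) ∕ dag-n20-w1 p590852, now at the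
mirror's names.

HONEST FRAMING.  Composition BY NAME; [folklore] bookkeeping; NO estimate of Bałaban's; the N21 ∕ N27x ∕ N19′ conjuncts and the dial rows in §3 are the OTHER lanes' content and are
HYPOTHESES asserted for no family; NO stub of K3ᴬ v8 is closed or claimed (stubs 0∕2); no `Provisos₁₃CoPHAx` inhabitant claimed (K0ᴬ OPEN); N19 ∕ N20 ∕ N21 ∕ N27 NOT discharged; NE7 ∕
NE7b ∕ NE7c NOT PRINTED for `d = 4`, NOT proved; counts UNMOVED (typed 28∕28 · discharged 8∕27 · A 8∕28 · K 1∕4).  One finite four-torus `𝕋⁴_{L^K}` at fixed `ε = L^{−K}`, Bałaban AS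
PRINTED — NOT ℝ⁴, NOT infinite volume, NOT OS, NOT a mass gap; the YM mass gap (Clay) is NOT proved by any of this.  No `def`, no `instance`, no `notation`, no `sorry`, standard axioms.
Sources (locators, bookkeeping only): [LF-II] Thm 1 + (0.1) pp.355–356, (1.80) p.384; [King1986] (3.10)–(3.11) p.656.
-/

set_option autoImplicit false

noncomputable section

namespace Summit.QuantumFields.YangMills.BalabanUVNodes.N20Stub2ShareK3AxV8

open Literature.MathematicalPhysics.QuantumFieldTheory.Balaban1983to89
open Literature.MathematicalPhysics.QuantumFieldTheory.Balaban1983to89.T4Continuum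
open T4WeightBudget (RelWeightBound)
open YMDAG.UVSplit
open Node00 (Stage13HParams chiβOfRecord₁₃Ax)
open Summit.QuantumFields.YangMills.Theorems.N21ShellSplitOfRecord13CoPH (WidthLetter₁₃CoPHAx DepthLetter₁₃CoPHAx)
open Summit.QuantumFields.YangMills.Theorems.N21GappedTopPair13CoPH (gapWeight2A₁₃Chi gapWeight2B₁₃Chi crGap2₁₃VAx)
open Summit.QuantumFields.YangMills.Theorems.K3AxV8Defs
open Summit.QuantumFields.YangMills.BalabanUVNodes.N20KeyedRelWeightAtGap2ReadingCmap (keyedRelWeight_shape_crGap2₁₃VAx_cutZero keyedRelWeight_shape_crGap2₁₃VAx_of_witness)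

/-! ## §1 The v8 pin at its intended witness (`rfl`, pinned everywhere) -/

/-- **THE DOUBLY-GAPPED RE-CENTRED READING AT A PER-TUPLE CUT READING SATISFIES THE v8 PIN** `PinnedAtLiveGap2 jc ρ ρ′ n₁ n₂` — `rfl` at every tuple (the live-line antecedent is not
used: the intended witness is pinned everywhere). [cite: Balaban1989LargeFieldII, (1.80) p.384 (bookkeeping)] -/
theorem pinnedAtLiveGap2_gap2Reading (jc : CutReading) (ρ ρ' : WidthLetter₁₃CoPHAx 2) (n₁ n₂ : DepthLetter₁₃CoPHAx 2) :
    PinnedAtLiveGap2 jc ρ ρ' n₁ n₂ (fun F θ hP g₀ os => crGap2₁₃VAx (jc F θ hP g₀ os) ρ ρ' n₁ n₂ F θ hP g₀ os) :=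
  fun _ _ _ _ _ _ => rfl

/-- … in particular at a TUPLE-BLIND policy `jcut` the reading `crGap2₁₃VAx jcut ρ ρ′ n₁ n₂` itself satisfies the pin of the constant cut reading. [cite: Balaban1989LargeFieldII, (1.80) p.384 (bookkeeping)] -/
theorem pinnedAtLiveGap2_crGap2₁₃VAx (jcut : ℕ → ℕ) (ρ ρ' : WidthLetter₁₃CoPHAx 2) (n₁ n₂ : DepthLetter₁₃CoPHAx 2) :
    PinnedAtLiveGap2 (fun _ _ _ _ _ => jcut) ρ ρ' n₁ n₂ (crGap2₁₃VAx jcut ρ ρ' n₁ n₂) :=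
  fun _ _ _ _ _ _ => rfl

/-! ## §2 Node N20's conjunct `KeyedRelWeight` at the doubly-gapped re-centred reading -/

/-- **★★ NODE N20's v8 CONJUNCT AT THE ZERO CUT HOLDS OUTRIGHT**: `KeyedRelWeight (crGap2₁₃VAx (fun _ ↦ 0) ρ ρ′ n₁ n₂)` for every dial — the bad class of the zero policy is empty,
`W ≡ 0` is admissible (✓p811026 `keyedRelWeight_shape_crGap2₁₃VAx_cutZero`, whose statement IS the mirror's `KeyedRelWeight` body).  NO estimate: the conjunct books nothing at
`jc ≡ 0`. [cite: King1986, (3.10) p.656; Balaban1989LargeFieldII, Thm 1 + (0.1) pp.355–356, (1.80) p.384 (bookkeeping)] -/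
theorem keyedRelWeight_crGap2₁₃VAx_cutZero (ρ ρ' : WidthLetter₁₃CoPHAx 2) (n₁ n₂ : DepthLetter₁₃CoPHAx 2) :
    KeyedRelWeight (crGap2₁₃VAx (fun _ => 0) ρ ρ' n₁ n₂) :=
  keyedRelWeight_shape_crGap2₁₃VAx_cutZero ρ ρ' n₁ n₂

/-- **★ NODE N20's v8 CONJUNCT AT ANY PER-TUPLE CUT READING FROM A KEYED WITNESS FAMILY** at the doubly-gapped re-centred carriers (`classSet₁₃Ax`, `gapWeight2A∕B₁₃Chi … (chiβOfRecord₁₃Ax …)`,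
`badClass₁₃Ax … (jc …)`): the socket a PRICED N20 face at a nonzero cut plugs into (`hW` is a HYPOTHESIS; NE7b NOT PRINTED for `d = 4`). [cite: Balaban1989LargeFieldII, Thm 1 + (0.1) pp.355–356, (1.79) p.383, (1.80) p.384, (1.89) p.387 (bookkeeping)] -/
theorem keyedRelWeight_gap2Reading_of_witness (jc : CutReading) (ρ ρ' : WidthLetter₁₃CoPHAx 2) (n₁ n₂ : DepthLetter₁₃CoPHAx 2)
    (W : (F : T4Family) → (θ : Stage13HParams F 2) → θ.Provisos₁₃CoPHAx F 2 → (ℕ → ℝ) → List (ULoop F) → ℕ → ℝ)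
    (hW : ∀ (F : T4Family) (θ : Stage13HParams F 2) (hP : θ.Provisos₁₃CoPHAx F 2), (θ.ZhUnity F 2 ∧ θ.SlotsNondegenerate₁₃Ax F 2) → θ.Admissible F 2 →
      ∀ (g₀ : ℕ → ℝ) (os : List (ULoop F)),
        RelWeightBound 1 (classSet₁₃Ax θ 0 g₀)
          (gapWeight2A₁₃Chi θ (chiβOfRecord₁₃Ax F 2 θ.toStage13Params) hP 0 g₀ os (ρ F θ hP g₀ os) (ρ' F θ hP g₀ os) (n₁ F θ hP g₀ os) (n₂ F θ hP g₀ os))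
          (gapWeight2B₁₃Chi θ (chiβOfRecord₁₃Ax F 2 θ.toStage13Params) hP 0 g₀ os (ρ F θ hP g₀ os) (ρ' F θ hP g₀ os) (n₁ F θ hP g₀ os) (n₂ F θ hP g₀ os))
          (badClass₁₃Ax θ 0 g₀ (jc F θ hP g₀ os)) (W F θ hP g₀ os)) :
    KeyedRelWeight (fun F θ hP g₀ os => crGap2₁₃VAx (jc F θ hP g₀ os) ρ ρ' n₁ n₂ F θ hP g₀ os) :=
  keyedRelWeight_shape_crGap2₁₃VAx_of_witness jc ρ ρ' n₁ n₂ W hW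

/-! ## §3 The stub-2 bill with node N20 paid -/

/-- **★★ THE REGISTERED STUB-2 TEXT WITH NODE N20's CONJUNCT AND THE PIN PAID AT THE ZERO CUT READING**: if for every `β` in print's window and every guarded, K4-faced reading
some dials `ρ ρ′ n₁ n₂` carry the dial rows and the N21 ∕ N27x ∕ N19′ conjuncts at `crGap2₁₃VAx (fun _ ↦ 0) ρ ρ′ n₁ n₂` (the OTHER lanes' content — HYPOTHESES here), then the stub-2
TEXT (`K3Skeleton13SepCoPHAxV8.stub_expansion13HV`'s type ∕ `K3AxV8StubTexts.Stub2TextV8`, byte for byte) holds, with witness `jc := fun _ _ _ _ _ ↦ fun _ ↦ 0`,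
`cr := crGap2₁₃VAx (fun _ ↦ 0) ρ ρ′ n₁ n₂` (§1 pin by `rfl`, §2 N20 outright).  At this witness the core-edge conjunct compares the two runs on ALL keyed classes (✓p811026
`classSet₁₃Ax_sdiff_badClass₁₃Ax_cutZero`) — NE7 proper, NOT PRINTED for `d = 4`.  NO stub is proved here. [cite: Balaban1989LargeFieldII, Thm 1 + (0.1) pp.355–356, (1.80) p.384; King1986, (3.10)–(3.11) p.656 (bookkeeping)] -/
theorem stub2Text_of_cutZero_faces
    (h : ∀ β : ℝ, 2 / 3 < β → β < 1 →
      ∀ (𝔯 : RateReading13AxP) (ksel : RunSel) (ℓ : LetterReading) (ℓ₃ : T4Family → Node00.NE3Letters₁₁) (g B : T4Family → ℝ),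
        GuardedReadingN16 𝔯 ksel ℓ ℓ₃ g B → KeyedRatesHolderD4V β (rrOfRecord 𝔯 ksel) →
        ∃ (ρ ρ' : WidthLetter₁₃CoPHAx 2) (n₁ n₂ : DepthLetter₁₃CoPHAx 2), DialRows ρ ρ' n₁ n₂ ∧
          KeyedShellWeight (crGap2₁₃VAx (fun _ => 0) ρ ρ' n₁ n₂) ∧ KeyedExtractionV (crGap2₁₃VAx (fun _ => 0) ρ ρ' n₁ n₂) ∧
          KeyedCoreEdgeHolderD4V β (crGap2₁₃VAx (fun _ => 0) ρ ρ' n₁ n₂) (rrOfRecord 𝔯 ksel)) :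
    ∀ β : ℝ, 2 / 3 < β → β < 1 →
      ∀ (𝔯 : RateReading13AxP) (ksel : RunSel) (ℓ : LetterReading) (ℓ₃ : T4Family → Node00.NE3Letters₁₁) (g B : T4Family → ℝ),
        GuardedReadingN16 𝔯 ksel ℓ ℓ₃ g B → KeyedRatesHolderD4V β (rrOfRecord 𝔯 ksel) →
        ∃ (jc : CutReading) (ρ ρ' : WidthLetter₁₃CoPHAx 2) (n₁ n₂ : DepthLetter₁₃CoPHAx 2) (cr : SpineReading), PinnedAtLiveGap2 jc ρ ρ' n₁ n₂ cr ∧ DialRows ρ ρ' n₁ n₂ ∧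
          KeyedRelWeight cr ∧ KeyedShellWeight cr ∧ KeyedExtractionV cr ∧ KeyedCoreEdgeHolderD4V β cr (rrOfRecord 𝔯 ksel) := by
  intro β hβ hβ' 𝔯 ksel ℓ ℓ₃ g B hg hr
  obtain ⟨ρ, ρ', n₁, n₂, hd, h21, hx, h19⟩ := h β hβ hβ' 𝔯 ksel ℓ ℓ₃ g B hg hr
  exact ⟨fun _ _ _ _ _ => fun _ => 0, ρ, ρ', n₁, n₂, crGap2₁₃VAx (fun _ => 0) ρ ρ' n₁ n₂, pinnedAtLiveGap2_crGap2₁₃VAx (fun _ => 0) ρ ρ' n₁ n₂, hd,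
    keyedRelWeight_crGap2₁₃VAx_cutZero ρ ρ' n₁ n₂, h21, hx, h19⟩

/-- **★ THE REGISTERED STUB-2 TEXT FROM THE FACES AT ANY PER-TUPLE CUT READING**: the same bill when the supplier chooses, per `β` and guarded K4-faced reading, a cut reading `jc`,
dials, a keyed N20 witness family `W, hW` at the doubly-gapped re-centred carriers of `jc` (§2's socket — node N20's PRICED face, a HYPOTHESIS; NE7b NOT PRINTED for `d = 4`) and
the N21 ∕ N27x ∕ N19′ conjuncts at `fun F θ hP g₀ os ↦ crGap2₁₃VAx (jc F θ hP g₀ os) ρ ρ′ n₁ n₂ F θ hP g₀ os` — where a nonzero cut enters the v8 bill.  NO stub is proved here.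
[cite: Balaban1989LargeFieldII, Thm 1 + (0.1) pp.355–356, (1.79) p.383, (1.80) p.384, (1.89) p.387; King1986, (3.10)–(3.11) p.656 (bookkeeping)] -/
theorem stub2Text_of_faces_at_cutReading
    (h : ∀ β : ℝ, 2 / 3 < β → β < 1 →
      ∀ (𝔯 : RateReading13AxP) (ksel : RunSel) (ℓ : LetterReading) (ℓ₃ : T4Family → Node00.NE3Letters₁₁) (g B : T4Family → ℝ),
        GuardedReadingN16 𝔯 ksel ℓ ℓ₃ g B → KeyedRatesHolderD4V β (rrOfRecord 𝔯 ksel) →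
        ∃ (jc : CutReading) (ρ ρ' : WidthLetter₁₃CoPHAx 2) (n₁ n₂ : DepthLetter₁₃CoPHAx 2)
          (W : (F : T4Family) → (θ : Stage13HParams F 2) → θ.Provisos₁₃CoPHAx F 2 → (ℕ → ℝ) → List (ULoop F) → ℕ → ℝ),
          (∀ (F : T4Family) (θ : Stage13HParams F 2) (hP : θ.Provisos₁₃CoPHAx F 2), (θ.ZhUnity F 2 ∧ θ.SlotsNondegenerate₁₃Ax F 2) → θ.Admissible F 2 →
            ∀ (g₀ : ℕ → ℝ) (os : List (ULoop F)),
              RelWeightBound 1 (classSet₁₃Ax θ 0 g₀)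
                (gapWeight2A₁₃Chi θ (chiβOfRecord₁₃Ax F 2 θ.toStage13Params) hP 0 g₀ os (ρ F θ hP g₀ os) (ρ' F θ hP g₀ os) (n₁ F θ hP g₀ os) (n₂ F θ hP g₀ os))
                (gapWeight2B₁₃Chi θ (chiβOfRecord₁₃Ax F 2 θ.toStage13Params) hP 0 g₀ os (ρ F θ hP g₀ os) (ρ' F θ hP g₀ os) (n₁ F θ hP g₀ os) (n₂ F θ hP g₀ os))
                (badClass₁₃Ax θ 0 g₀ (jc F θ hP g₀ os)) (W F θ hP g₀ os)) ∧
          DialRows ρ ρ' n₁ n₂ ∧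
          KeyedShellWeight (fun F θ hP g₀ os => crGap2₁₃VAx (jc F θ hP g₀ os) ρ ρ' n₁ n₂ F θ hP g₀ os) ∧
          KeyedExtractionV (fun F θ hP g₀ os => crGap2₁₃VAx (jc F θ hP g₀ os) ρ ρ' n₁ n₂ F θ hP g₀ os) ∧
          KeyedCoreEdgeHolderD4V β (fun F θ hP g₀ os => crGap2₁₃VAx (jc F θ hP g₀ os) ρ ρ' n₁ n₂ F θ hP g₀ os) (rrOfRecord 𝔯 ksel)) :
    ∀ β : ℝ, 2 / 3 < β → β < 1 →
      ∀ (𝔯 : RateReading13AxP) (ksel : RunSel) (ℓ : LetterReading) (ℓ₃ : T4Family → Node00.NE3Letters₁₁) (g B : T4Family → ℝ),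
        GuardedReadingN16 𝔯 ksel ℓ ℓ₃ g B → KeyedRatesHolderD4V β (rrOfRecord 𝔯 ksel) →
        ∃ (jc : CutReading) (ρ ρ' : WidthLetter₁₃CoPHAx 2) (n₁ n₂ : DepthLetter₁₃CoPHAx 2) (cr : SpineReading), PinnedAtLiveGap2 jc ρ ρ' n₁ n₂ cr ∧ DialRows ρ ρ' n₁ n₂ ∧
          KeyedRelWeight cr ∧ KeyedShellWeight cr ∧ KeyedExtractionV cr ∧ KeyedCoreEdgeHolderD4V β cr (rrOfRecord 𝔯 ksel) := by
  intro β hβ hβ' 𝔯 ksel ℓ ℓ₃ g B hg hr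
  obtain ⟨jc, ρ, ρ', n₁, n₂, W, hW, hd, h21, hx, h19⟩ := h β hβ hβ' 𝔯 ksel ℓ ℓ₃ g B hg hr
  exact ⟨jc, ρ, ρ', n₁, n₂, fun F θ hP g₀ os => crGap2₁₃VAx (jc F θ hP g₀ os) ρ ρ' n₁ n₂ F θ hP g₀ os, pinnedAtLiveGap2_gap2Reading jc ρ ρ' n₁ n₂, hd,
    keyedRelWeight_gap2Reading_of_witness jc ρ ρ' n₁ n₂ W hW, h21, hx, h19⟩

end Summit.QuantumFields.YangMills.BalabanUVNodes.N20Stub2ShareK3AxV8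

end
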